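import Literature.RepresentationTheory.FiniteGroups.GL2ModularPrincipalSeriesCoordTwist
import HarnessLib

/-!
# The invariant pairing `𝓑(χ₁, χ₂) × 𝓑(χ₁⁻¹, χ₂⁻¹) → k` is the dot product in Bruhat coordinates; dual lattices

Topic `Literature/RepresentationTheory/FiniteGroups`, namespace `Literature.RepresentationTheory.FiniteGroups.GL2`
(sequel of `GL2ModularPrincipalSeriesBruhatBasis` / `…LatticeReduction` / `…CoordTwist`).  DEFINITIONS (`bruhatIndex`, `bruhatRep`,
`dualLattice`) + API (reviewed kind); no named fact, no instance, no notation, no `sorry`.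

For characters `χ₁, χ₂ : Fˣ → kˣ` the pairing `⟨f₁, f₂⟩ = Σ_{x ∈ B\G} f₁(x) f₂(x)` between `Ind_B^G(χ₁ ⊗ χ₂)` and
`Ind_B^G(χ₁⁻¹ ⊗ χ₂⁻¹)` is well defined (`f₁f₂` is left `B`-invariant) and `G`-invariant (the contragredient of an
induced representation is induced from the contragredient) [Bump1997, §4.1, Prop. 4.1.1/Exercise 4.1.2 (Mackey);
SerreLinearRepresentations1977, §7.1].  With the Bruhat representatives `1`, `w u(t)` of `B\GL₂(F) = ℙ¹(F)` it is the
DOT PRODUCT of Bruhat coordinates: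

* `bruhatIndex x ∈ Option F` (the coset of `x` in `B\G`: `none` if `x ∈ B`, `some (x₁₁/x₁₀)` otherwise), `bruhatRep`
  (the representatives), `bruhatIndex_borel_mul`, `bruhatIndex_bruhatRep`, `exists_borel_mul_bruhatRep`
  (`x = b · rep(idx x)`), `apply_eq_borelCharacter_mul_bruhatEval` (`f(x) = χ(b) · f(rep(idx x))`);
* `bruhatPerm g : Option F ≃ Option F` — the right action of `g` on `B\G`;
* **`apply_mul_apply_eq`**: for `f₁ ∈ 𝓑(χ₁,χ₂)`, `f₂ ∈ 𝓑(χ₁⁻¹,χ₂⁻¹)`: `f₁(x) f₂(x) = e₁(idx x) e₂(idx x)` (`eᵢ` the Bruhat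
  coordinates); **`dotProduct_coordRep_coordRep_inv`**: `⟨coordRep χ₁ χ₂ g v, coordRep χ₁⁻¹ χ₂⁻¹ g w⟩ = ⟨v, w⟩`;
* `dualLattice S a = {v | ∀ w ∈ S, a ∣ v ⬝ᵥ w}` (an `R`-submodule), its `G`-stability under the inverse-character model
  when `S` is stable (`coordRep_mem_dualLattice`), and **`dualLattice_smul_top`**: over a domain, for `c ≠ 0`,
  `dualLattice (c • ⊤) (c * a) = a • ⊤` — the dual of a homothetic copy of the standard lattice is a homothetic copy
  of the standard lattice of the inverse-character model.
-/

noncomputable section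

namespace Literature.RepresentationTheory.FiniteGroups

namespace GL2

open Matrix Finset Pointwise

/-! ## The index map `GL₂(F) → B\GL₂(F) = Option F` and representatives -/
section Index

variable {F : Type} [Field F] [DecidableEq F]

/-- The coset index of `x` in `B\GL₂(F) ≃ ℙ¹(F) ≃ Option F`: `none` on the small cell `B`, `some (x₁₁/x₁₀)` on
the big cell `B w u(x₁₁/x₁₀)`. [cite: Bump1997, §4.1 Eq. (1.7)] -/
def bruhatIndex (x : GL (Fin 2) F) : Option F :=
  if (x : Matrix (Fin 2) (Fin 2) F) 1 0 = 0 then none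
  else some ((x : Matrix (Fin 2) (Fin 2) F) 1 1 / (x : Matrix (Fin 2) (Fin 2) F) 1 0)

/-- The Bruhat representatives: `none ↦ 1`, `some t ↦ w u(t)`. [cite: Bump1997, §4.1 Eq. (1.7)] -/
def bruhatRep (o : Option F) : GL (Fin 2) F :=
  Option.elim o 1 fun t => weyl F * upperUnip F t

omit [DecidableEq F] in
/-- `rep none = 1`. [cite: Bump1997, §4.1 Eq. (1.7)] -/
@[simp] theorem bruhatRep_none : bruhatRep (none : Option F) = 1 := rfl

omit [DecidableEq F] in
/-- `rep (some t) = w u(t)`. [cite: Bump1997, §4.1 Eq. (1.7)] -/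
@[simp] theorem bruhatRep_some (t : F) : bruhatRep (some t) = weyl F * upperUnip F t := rfl

/-- `idx x = none` on the Borel subgroup. [cite: Bump1997, §4.1 Eq. (1.7)] -/
theorem bruhatIndex_of_eq {x : GL (Fin 2) F} (hx : (x : Matrix (Fin 2) (Fin 2) F) 1 0 = 0) :
    bruhatIndex x = none := by
  simp [bruhatIndex, hx]

/-- `idx x = some (x₁₁/x₁₀)` on the big cell. [cite: Bump1997, §4.1 Eq. (1.7)] -/
theorem bruhatIndex_of_ne {x : GL (Fin 2) F} (hx : (x : Matrix (Fin 2) (Fin 2) F) 1 0 ≠ 0) :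
    bruhatIndex x = some ((x : Matrix (Fin 2) (Fin 2) F) 1 1 / (x : Matrix (Fin 2) (Fin 2) F) 1 0) := by
  simp [bruhatIndex, hx]

/-- The index is left-`B`-invariant. [cite: Bump1997, §4.1 Eq. (1.7)] -/
theorem bruhatIndex_borel_mul (b : borel F) (x : GL (Fin 2) F) :
    bruhatIndex ((b : GL (Fin 2) F) * x) = bruhatIndex x := by
  by_cases hx : (x : Matrix (Fin 2) (Fin 2) F) 1 0 = 0
  · rw [bruhatIndex_of_eq hx, bruhatIndex_of_eq (by rw [borel_mul_apply_one_zero, hx, mul_zero])]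
  · rw [bruhatIndex_of_ne hx, bruhatIndex_of_ne ((borel_mul_apply_one_zero_ne_zero_iff b x).mpr hx), borel_mul_ratio]

/-- `idx (rep o) = o`. [cite: Bump1997, §4.1 Eq. (1.7)] -/
theorem bruhatIndex_bruhatRep (o : Option F) : bruhatIndex (bruhatRep o) = o := by
  cases o with
  | none => exact bruhatIndex_of_eq one_apply_one_zero
  | some t =>
    have h := weyl_mul_upperUnip_apply_one_zero (F := F) t
    rw [bruhatRep_some, bruhatIndex_of_ne (by rw [h]; exact one_ne_zero), weyl_mul_upperUnip_apply_one_one, h, div_one]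

/-- **Bruhat decomposition**: every `x` is `b · rep(idx x)` for some `b ∈ B`. [cite: Bump1997, §4.1 Eq. (1.7)] -/
theorem exists_borel_mul_bruhatRep (x : GL (Fin 2) F) :
    ∃ b : borel F, x = (b : GL (Fin 2) F) * bruhatRep (bruhatIndex x) := by
  by_cases hx : (x : Matrix (Fin 2) (Fin 2) F) 1 0 = 0
  · exact ⟨⟨x, (mem_borel_iff x).mpr hx⟩, by rw [bruhatIndex_of_eq hx, bruhatRep_none, mul_one]⟩
  · exact ⟨bruhatBorel x hx, by rw [bruhatIndex_of_ne hx, bruhatRep_some, ← mul_assoc]; exact bruhat_eq x hx⟩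

/-- `idx (rep(idx y) · h) = idx (y · h)`: the index of a product only depends on the coset of the left factor.
[cite: Bump1997, §4.1 Eq. (1.7)] -/
theorem bruhatIndex_bruhatRep_mul (y h : GL (Fin 2) F) :
    bruhatIndex (bruhatRep (bruhatIndex y) * h) = bruhatIndex (y * h) := by
  obtain ⟨b, hb⟩ := exists_borel_mul_bruhatRep y
  conv_rhs => rw [hb, mul_assoc, bruhatIndex_borel_mul]

/-- **The right action of `GL₂(F)` on `B\GL₂(F) = Option F`**: `o ↦ idx(rep(o) · g)`, a permutation with inverse
`o ↦ idx(rep(o) · g⁻¹)`. [cite: Bump1997, §4.1 Eq. (1.7)] -/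
def bruhatPerm (g : GL (Fin 2) F) : Option F ≃ Option F where
  toFun o := bruhatIndex (bruhatRep o * g)
  invFun o := bruhatIndex (bruhatRep o * g⁻¹)
  left_inv o := by
    simp only
    rw [bruhatIndex_bruhatRep_mul, mul_assoc, mul_inv_cancel, mul_one, bruhatIndex_bruhatRep]
  right_inv o := by
    simp only
    rw [bruhatIndex_bruhatRep_mul, mul_assoc, inv_mul_cancel, mul_one, bruhatIndex_bruhatRep]

/-- Unfolding. [cite: Bump1997, §4.1 Eq. (1.7)] -/
theorem bruhatPerm_apply (g : GL (Fin 2) F) (o : Option F) : bruhatPerm g o = bruhatIndex (bruhatRep o * g) := rfl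

end Index

/-! ## Functions of the principal series in terms of their Bruhat coordinates -/
section Values

variable {F : Type} [Field F] [DecidableEq F] {k : Type*} [CommRing k] (χ₁ χ₂ : Fˣ →* kˣ)

omit [DecidableEq F] in
/-- `f(rep o) = (bruhatEval f) o`. [cite: Bump1997, §4.1 Eq. (1.7)] -/
theorem apply_bruhatRep (f : Representation.coindV (borel F).subtype (scalarRep (borelCharacter F χ₁ χ₂)))
    (o : Option F) : (f : GL (Fin 2) F → k) (bruhatRep o) = bruhatEval χ₁ χ₂ f o := by
  cases o with
  | none => rw [bruhatRep_none, bruhatEval_none]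
  | some t => rw [bruhatRep_some, bruhatEval_some]

omit [DecidableEq F] in
/-- The Borel character of the inverse characters is the inverse: `χ_{χ₁⁻¹,χ₂⁻¹}(b) = χ_{χ₁,χ₂}(b)⁻¹`.
[cite: Bump1997, §4.1 Eq. (1.6)] -/
theorem borelCharacter_inv (b : borel F) : borelCharacter F χ₁⁻¹ χ₂⁻¹ b = (borelCharacter F χ₁ χ₂ b)⁻¹ := by
  rw [borelCharacter_apply, borelCharacter_apply, MonoidHom.inv_apply, MonoidHom.inv_apply, mul_inv]

/-- **The product of a function of `𝓑(χ₁,χ₂)` and a function of `𝓑(χ₁⁻¹,χ₂⁻¹)` is `B`-invariant and reads on Bruhat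
coordinates**: `f₁(x) f₂(x) = e₁(idx x) e₂(idx x)`. [cite: Bump1997, §4.1 Prop. 4.1.1] -/
theorem apply_mul_apply_eq (f₁ : Representation.coindV (borel F).subtype (scalarRep (borelCharacter F χ₁ χ₂)))
    (f₂ : Representation.coindV (borel F).subtype (scalarRep (borelCharacter F χ₁⁻¹ χ₂⁻¹))) (x : GL (Fin 2) F) :
    (f₁ : GL (Fin 2) F → k) x * (f₂ : GL (Fin 2) F → k) x =
      bruhatEval χ₁ χ₂ f₁ (bruhatIndex x) * bruhatEval χ₁⁻¹ χ₂⁻¹ f₂ (bruhatIndex x) := by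
  obtain ⟨b, hb⟩ := exists_borel_mul_bruhatRep x
  conv_lhs => rw [hb]
  rw [apply_borel_mul, apply_borel_mul, apply_bruhatRep, apply_bruhatRep, borelCharacter_inv]
  calc (borelCharacter F χ₁ χ₂ b : k) * bruhatEval χ₁ χ₂ f₁ (bruhatIndex x) *
        (((borelCharacter F χ₁ χ₂ b)⁻¹ : kˣ) * bruhatEval χ₁⁻¹ χ₂⁻¹ f₂ (bruhatIndex x))
      = ((borelCharacter F χ₁ χ₂ b : k) * ((borelCharacter F χ₁ χ₂ b)⁻¹ : kˣ)) *
          (bruhatEval χ₁ χ₂ f₁ (bruhatIndex x) * bruhatEval χ₁⁻¹ χ₂⁻¹ f₂ (bruhatIndex x)) := by ring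
    _ = _ := by rw [Units.mul_inv, one_mul]

variable [Fintype F]

/-- **`G`-invariance of the pairing in Bruhat coordinates**: for all `g`,
`Σ_o (g·v)(o) (g·w)(o) = Σ_o v(o) w(o)`, where `g` acts on `v` through `coordRep χ₁ χ₂` and on `w` through
`coordRep χ₁⁻¹ χ₂⁻¹` — the pairing `⟨f₁,f₂⟩ = Σ_{B\G} f₁ f₂` between `Ind(χ)` and `Ind(χ⁻¹)` is invariant (substitute the
permutation `o ↦ o·g` of `B\G`). [cite: Bump1997, §4.1 Prop. 4.1.1] -/
theorem dotProduct_coordRep_coordRep_inv (g : GL (Fin 2) F) (v w : Option F → k) :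
    coordRep χ₁ χ₂ g v ⬝ᵥ coordRep χ₁⁻¹ χ₂⁻¹ g w = v ⬝ᵥ w := by
  simp only [dotProduct]
  have key : ∀ o : Option F, coordRep χ₁ χ₂ g v o * coordRep χ₁⁻¹ χ₂⁻¹ g w o =
      v (bruhatPerm g o) * w (bruhatPerm g o) := by
    intro o
    rw [coordRep_apply, coordRep_apply, ← apply_bruhatRep, ← apply_bruhatRep, principalSeriesRep_apply_coe,
      principalSeriesRep_apply_coe, apply_mul_apply_eq, bruhatEval_bruhatLift, bruhatEval_bruhatLift, bruhatPerm_apply]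
  simp_rw [key]
  exact Equiv.sum_comp (bruhatPerm g) (fun o => v o * w o)

end Values

/-! ## Dual lattices with respect to the dot product -/
section Dual

variable {ι : Type*} [Fintype ι] {R : Type*} [CommRing R]

/-- The `a`-dual of a submodule `S ⊆ (ι → R)` for the dot product: `{v | ∀ w ∈ S, a ∣ v ⬝ᵥ w}` (for `S` of finite
index containing `a·⊤` this is `a` times the honest dual lattice `{v ∈ Frac(R)^ι | ⟨v, S⟩ ⊆ R}`).
[cite: SerreLinearRepresentations1977, §15.2] -/
def dualLattice (S : Submodule R (ι → R)) (a : R) : Submodule R (ι → R) where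
  carrier := {v | ∀ w ∈ S, a ∣ v ⬝ᵥ w}
  add_mem' hv hv' w hw := by rw [add_dotProduct]; exact dvd_add (hv w hw) (hv' w hw)
  zero_mem' w hw := by rw [zero_dotProduct]; exact dvd_zero a
  smul_mem' c v hv w hw := by rw [smul_dotProduct, smul_eq_mul]; exact Dvd.dvd.mul_left (hv w hw) c

/-- Membership. [cite: SerreLinearRepresentations1977, §15.2] -/
theorem mem_dualLattice_iff (S : Submodule R (ι → R)) (a : R) (v : ι → R) :
    v ∈ dualLattice S a ↔ ∀ w ∈ S, a ∣ v ⬝ᵥ w :=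
  Iff.rfl

variable [DecidableEq ι]

/-- **The dual of a homothetic copy of the standard lattice**: over a domain, for `c ≠ 0`,
`dualLattice (c·⊤) (c·a) = a·⊤`. [cite: SerreLinearRepresentations1977, §15.2] -/
theorem dualLattice_smul_top [IsDomain R] {c : R} (hc : c ≠ 0) (a : R) :
    dualLattice (c • (⊤ : Submodule R (ι → R))) (c * a) = a • (⊤ : Submodule R (ι → R)) := by
  ext v
  rw [mem_dualLattice_iff]
  constructor
  · intro hv
    -- test against `c • single i 1`
    have hi : ∀ i, a ∣ v i := fun i => by
      have h := hv (c • Pi.single i 1) (Submodule.smul_mem_pointwise_smul _ _ _ Submodule.mem_top)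
      rw [dotProduct_smul, dotProduct_single, mul_one, smul_eq_mul] at h
      exact (mul_dvd_mul_iff_left hc).mp h
    choose u hu using hi
    refine (Submodule.mem_smul_pointwise_iff_exists _ _ _).mpr ⟨u, Submodule.mem_top, ?_⟩
    funext i
    rw [Pi.smul_apply, smul_eq_mul, hu i]
  · intro hv w hw
    obtain ⟨u, -, rfl⟩ := (Submodule.mem_smul_pointwise_iff_exists _ _ _).mp hv
    obtain ⟨w', -, rfl⟩ := (Submodule.mem_smul_pointwise_iff_exists _ _ _).mp hw
    rw [smul_dotProduct, dotProduct_smul, smul_eq_mul, smul_eq_mul]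
    exact ⟨u ⬝ᵥ w', by ring⟩

/-- If `c·⊤ ⊆ S` then `dualLattice S (c·a) ⊆ a·⊤` (over a domain, `c ≠ 0`). [cite: SerreLinearRepresentations1977, §15.2] -/
theorem dualLattice_le_smul_top [IsDomain R] {c : R} (hc : c ≠ 0) (a : R) {S : Submodule R (ι → R)}
    (hS : c • (⊤ : Submodule R (ι → R)) ≤ S) : dualLattice S (c * a) ≤ a • (⊤ : Submodule R (ι → R)) := by
  intro v hv
  rw [← dualLattice_smul_top hc a]
  exact fun w hw => hv w (hS hw)

end Dual

/-! ## The dual lattice is stable under the inverse-character model -/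
section DualStable

variable {F : Type} [Field F] [Fintype F] [DecidableEq F] {R : Type*} [CommRing R] (χ₁ χ₂ : Fˣ →* Rˣ)

/-- **`G`-stability of the dual lattice**: if `S ⊆ coordRep χ₁ χ₂` is `GL₂(F)`-stable then `dualLattice S a` is stable
under `coordRep χ₁⁻¹ χ₂⁻¹` (invariance of the pairing). [cite: Bump1997, §4.1 Prop. 4.1.1] -/
theorem coordRep_inv_mem_dualLattice {S : Submodule R (Option F → R)}
    (hS : ∀ (g : GL (Fin 2) F) (w : Option F → R), w ∈ S → coordRep χ₁ χ₂ g w ∈ S) (a : R) (g : GL (Fin 2) F)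
    {v : Option F → R} (hv : v ∈ dualLattice S a) : coordRep χ₁⁻¹ χ₂⁻¹ g v ∈ dualLattice S a := by
  intro w hw
  have hw' : coordRep χ₁ χ₂ g⁻¹ w ∈ S := hS g⁻¹ w hw
  have hgw : coordRep χ₁ χ₂ g (coordRep χ₁ χ₂ g⁻¹ w) = w := by
    rw [← Module.End.mul_apply, ← map_mul, mul_inv_cancel, map_one, Module.End.one_apply]
  rw [← hgw, dotProduct_comm, dotProduct_coordRep_coordRep_inv, dotProduct_comm]
  exact hv _ hw'

end DualStable

end GL2

end Literature.RepresentationTheory.FiniteGroups
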